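import Summits.CriticalPhenomena.CardyFormulaZ2.Theorems.UniformBoxCrossing.Negative.StaircaseWorld
import HarnessLib

/-!
# The staircase world has exact-`1/2` squares and no box crossing: positive association,
# the Klein symmetries, self-duality and exact `1/2` do NOT imply the box-crossing property
(negative-side support for crux `UniformBoxCrossing`, stmt-CriticalPhenomena-5476; line lead c3;
part 2 of 2)

* `stairWorld_real_lrCrossing_succ_self`: `LR([0, n+1] × [0, n])` happens iff the staircase `S₀`
  through `(0,0), (1,0), (1,1), …, (n+1, n)` is open, i.e. iff `0 ∈ ξ`: probability EXACTLY `1/2`.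
* `stair_hardWay_le`: a horizontal crossing of `w + [0, 8n] × [0, n]` on `√2 ℤ²` raises the level
  `v₀ - v₁` by at least `4n`, hence needs `4n` consecutive open staircases: probability
  `≤ 2 (n + 1) 16⁻ⁿ`; so `¬ HasBoxCrossingProperty stairWorld`.
* Capstone `exists_fkg_selfDual_symmetric_exactHalf_not_boxCrossing`: a POSITIVELY ASSOCIATED,
  translation-, transposition- and point-reflection-invariant, exactly self-dual probability measure
  on bond configurations of `ℤ²` with all `(n+1) × n` rectangles crossed with probability exactly
  `1/2` and without the box-crossing property. It adds positive association (FKG) to the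
  disprover's capstone `exists_selfDual_symmetric_exactHalf_not_boxCrossing` (laminated model, not
  FKG): Köhler-Schindler–Tassion's Theorem 1 (arXiv:2011.04618) does not extend from the symmetry
  group of `ℤ²` to the Klein group `⟨σ, -1⟩ ⋉ ℤ²` even under exact self-duality, so the kernel of
  `UniformBoxCrossing` needs the finite-range product structure of `M_t` QUANTITATIVELY as well as FKG.
-/

namespace Summit.CriticalPhenomena.CardyFormulaZ2.Theorems.UniformBoxCrossing.Negative

open MeasureTheory Filter Literature.Probability.Percolation Literature.Probability.LatticeModels
open scoped Topology

noncomputable section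

/-! ### Exact `1/2`: the square crossing is the single staircase `S₀` -/

/-- The vertex `(k + 1, k)` of the staircase `S₀`. -/
theorem stairPt_add_single_one (k : ℕ) :
    (![(k : ℤ) + 1, k] : Site 2) + Pi.single 1 1 = ![(k : ℤ) + 1, (k : ℤ) + 1] := by
  rw [Site.eq_iff_two]; simp

/-- The vertex `(k + 1, k + 1)` of the staircase `S₀`. -/
theorem stairPt_add_single_zero (k : ℕ) :
    (![(k : ℤ) + 1, (k : ℤ) + 1] : Site 2) + Pi.single 0 1 = ![((k + 1 : ℕ) : ℤ) + 1, (k + 1 : ℕ)] := by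
  rw [Site.eq_iff_two]; simp

/-- The first vertex `(1, 0)` of the staircase `S₀` after the origin. -/
theorem origin_add_single_zero : (![0, 0] : Site 2) + Pi.single 0 1 = ![((0 : ℕ) : ℤ) + 1, ((0 : ℕ) : ℤ)] := by
  rw [Site.eq_iff_two]; simp

/-- **If `0 ∈ ξ`, the staircase `S₀` is an open path inside `[0, n+1] × [0, n]` from `(0, 0)` to
`(k + 1, k)`**, for every `k ≤ n`. -/
theorem stair_openConnIn {ξ : Set ℤ} (h0 : (0 : ℤ) ∈ ξ) (n : ℕ) :
    ∀ k : ℕ, k ≤ n → stairConfig ξ ∈ openConnIn (↑(rectangle (n + 1) n)) ![0, 0] ![(k : ℤ) + 1, k] := by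
  have htrans : ∀ {x y z : Site 2}, stairConfig ξ ∈ openConnIn (↑(rectangle (n + 1) n)) x y →
      stairConfig ξ ∈ openConnIn (↑(rectangle (n + 1) n)) y z →
      stairConfig ξ ∈ openConnIn (↑(rectangle (n + 1) n)) x z := by
    rintro x y z ⟨hx, hy, h⟩ ⟨hy', hz, h'⟩
    exact ⟨hx, hz, h.trans h'⟩
  intro k
  induction k with
  | zero =>
    intro _
    refine openConnIn_of_adj (by simp [mem_rectangle_iff]; omega) (by simp [mem_rectangle_iff]) ?_ ?_
    · have he : s((![0, 0] : Site 2), ![((0 : ℕ) : ℤ) + 1, ((0 : ℕ) : ℤ)]) = cornerEdge (![0, 0], 0) := by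
        rw [← origin_add_single_zero]; rfl
      rw [he, cornerEdge_mem_stairConfig_iff]
      simpa [stairIdx, stairLevel] using h0
    · intro h
      have := congr_fun h 0
      simp at this
  | succ k ih =>
    intro hk
    have h1 : stairConfig ξ ∈ openConnIn (↑(rectangle (n + 1) n)) ![(k : ℤ) + 1, k] ![(k : ℤ) + 1, (k : ℤ) + 1] := by
      refine openConnIn_of_adj ?_ ?_ ?_ ?_
      · simp [mem_rectangle_iff]; omega
      · simp [mem_rectangle_iff]; omega
      · have he : s((![(k : ℤ) + 1, k] : Site 2), ![(k : ℤ) + 1, (k : ℤ) + 1]) =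
            cornerEdge (![(k : ℤ) + 1, k], 1) := by
          rw [← stairPt_add_single_one]; rfl
        rw [he, cornerEdge_mem_stairConfig_iff]
        simpa [stairIdx, stairLevel] using h0
      · intro h
        have := congr_fun h 1
        simp at this
    have h2 : stairConfig ξ ∈ openConnIn (↑(rectangle (n + 1) n)) ![(k : ℤ) + 1, (k : ℤ) + 1]
        ![((k + 1 : ℕ) : ℤ) + 1, (k + 1 : ℕ)] := by
      refine openConnIn_of_adj ?_ ?_ ?_ ?_
      · simp [mem_rectangle_iff]; omega
      · simp [mem_rectangle_iff]; omega
      · have he : s((![(k : ℤ) + 1, (k : ℤ) + 1] : Site 2), ![((k + 1 : ℕ) : ℤ) + 1, (k + 1 : ℕ)]) =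
            cornerEdge (![(k : ℤ) + 1, (k : ℤ) + 1], 0) := by
          rw [← stairPt_add_single_zero]; rfl
        rw [he, cornerEdge_mem_stairConfig_iff]
        simpa [stairIdx, stairLevel] using h0
      · intro h
        have := congr_fun h 0
        simp at this
    exact htrans (htrans (ih (Nat.le_of_succ_le hk)) h1) h2

/-- **`0 ∈ ξ` ⇒ the `(n+1) × n` rectangle is crossed** (by `S₀`). -/
theorem lrCrossing_of_zero_mem {ξ : Set ℤ} (h0 : (0 : ℤ) ∈ ξ) (n : ℕ) :
    stairConfig ξ ∈ lrCrossing (n + 1) n := by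
  refine ⟨![0, 0], ?_, ![((n : ℕ) : ℤ) + 1, n], ?_, stair_openConnIn h0 n n le_rfl⟩
  · simp [leftSide, mem_rectangle_iff]; omega
  · simp [rightSide, mem_rectangle_iff]; omega

/-- **A crossing of the `(n+1) × n` rectangle forces `0 ∈ ξ`**: it must raise the level from
`≤ 0` (left side) to `≥ 1` (right side), through the step `0 → 1`, along an edge of `S₀`. -/
theorem zero_mem_of_lrCrossing {ξ : Set ℤ} {n : ℕ} (h : stairConfig ξ ∈ lrCrossing (n + 1) n) :
    (0 : ℤ) ∈ ξ := by
  obtain ⟨x, hx, y, hy, -, -, hlev⟩ := exists_endpoints_of_mem_openCrossing h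
  simp only [Finset.mem_coe, leftSide, rightSide, Finset.mem_filter, mem_rectangle_iff] at hx hy
  refine hlev 0 ?_ ?_
  · simp only [stairLevel]; omega
  · simp only [stairLevel]; omega

/-- The square-crossing event pulled back to the coins is the coordinate event `{0 ∈ ξ}`. -/
theorem preimage_stairConfig_lrCrossing (n : ℕ) :
    stairConfig ⁻¹' lrCrossing (n + 1) n = {ξ | (0 : ℤ) ∈ ξ} :=
  Set.ext fun _ => ⟨zero_mem_of_lrCrossing, fun h => lrCrossing_of_zero_mem h n⟩

/-- **The staircase world crosses EVERY `(n+1) × n` rectangle with probability exactly `1/2`.** -/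
theorem stairWorld_real_lrCrossing_succ_self (n : ℕ) :
    stairWorld.real (lrCrossing (n + 1) n) = 1 / 2 := by
  have hm : MeasurableSet (lrCrossing (n + 1) n) := measurableSet_openCrossing_of_countable _ _ _
  rw [stairWorld_real_apply hm, preimage_stairConfig_lrCrossing, prodBernoulli_real_setOf_mem, coe_half]

/-! ### No box crossing: long crossings need many consecutive open staircases -/

/-- **Deterministic core.** A horizontal crossing of `w + [0, 8n] × [0, n]` on `√2 ℤ²` by the
staircase configuration of `ξ` starts at a vertex `x` of the start box whose whole level window
lies in `ξ` (the crossing gains `> 5n` in the first coordinate and at most `n` in the second, so it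
raises the level by at least `4n`). -/
theorem stair_crossing_window (ξ : Set ℤ) (w : ℂ) (n : ℕ)
    (h : stairConfig ξ ∈ embRectCrossing (fun v => squareLatticeEmbedding.z v - w) (8 * n) n) :
    ∃ x ∈ startBox w n, ↑(levelWindow x n) ⊆ ξ := by
  obtain ⟨x, hxA, y, hyB, hxT, hyT, hlev⟩ := exists_endpoints_of_mem_openCrossing h
  simp only [Set.mem_setOf_eq] at hxA hyB hxT hyT
  refine ⟨x, mem_startBox ⟨hxT.1.1, hxA⟩ hxT.2, fun d hd => ?_⟩
  rw [Finset.mem_coe, levelWindow, Finset.mem_Ico] at hd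
  have hr1 := Real.one_lt_sqrt_two
  have hr2 := sqrt_two_lt'
  simp only [Complex.sub_re, Complex.sub_im, TrackExchange.zsq_re, TrackExchange.zsq_im,
    Set.mem_Icc] at hxA hyB hxT hyT
  -- first coordinate gains more than `5n`
  have h0 : 5 * (n : ℤ) ≤ y 0 - x 0 := by
    have h1 : (8 * n : ℝ) ≤ Real.sqrt 2 * (y 0 - x 0) := by nlinarith [hyB, hxA]
    have h2 : (0 : ℝ) ≤ y 0 - x 0 := by nlinarith
    have h3 : (5 * n : ℝ) ≤ y 0 - x 0 := by nlinarith
    exact_mod_cast h3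
  -- second coordinate gains at most `n`
  have h1 : y 1 - x 1 ≤ (n : ℤ) := by
    have h1 : Real.sqrt 2 * (y 1 - x 1) ≤ n := by nlinarith [hyT.2.2, hxT.2.1]
    by_cases hs : (0 : ℝ) ≤ y 1 - x 1
    · have h3 : (y 1 : ℝ) - x 1 ≤ n := by nlinarith
      exact_mod_cast h3
    · have h3 : (y 1 : ℝ) - x 1 ≤ n := by
        have : (0 : ℝ) ≤ n := Nat.cast_nonneg n
        linarith [not_le.1 hs]
      exact_mod_cast h3
  refine hlev d hd.1 ?_
  simp only [stairLevel] at hd ⊢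
  omega

/-- **Staircase bound.** The horizontal crossing probability of `w + [0, 8n] × [0, n]` on `√2 ℤ²`
under the staircase world is at most `2 (n + 1) 16⁻ⁿ`, uniformly in `w`. -/
theorem stair_hardWay_le (w : ℂ) (n : ℕ) :
    stairWorld.real (embRectCrossing (fun v => squareLatticeEmbedding.z v - w) (8 * n) n) ≤
      2 * (n + 1) * (1 / 16 : ℝ) ^ n := by
  set E := embRectCrossing (fun v => squareLatticeEmbedding.z v - w) (8 * n) n with hE
  have hEm : MeasurableSet E := measurableSet_openCrossing_of_countable _ _ _
  rw [stairWorld_real_apply hEm]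
  set μ := prodBernoulli fun _ : ℤ => half with hμ
  have hsub : stairConfig ⁻¹' E ⊆ ⋃ x ∈ startBox w n, {ξ | ↑(levelWindow x n) ⊆ ξ} := by
    intro ξ hξ
    obtain ⟨x, hx, hwin⟩ := stair_crossing_window ξ w n hξ
    simp only [Set.mem_iUnion, exists_prop]
    exact ⟨x, hx, hwin⟩
  have hcyl : ∀ x : Site 2, μ.real {ξ | ↑(levelWindow x n) ⊆ ξ} = (1 / 16 : ℝ) ^ n := by
    intro x
    rw [hμ, prodBernoulli_real_subset, Finset.prod_const, card_levelWindow, coe_half, pow_mul]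
    norm_num
  calc μ.real (stairConfig ⁻¹' E)
      ≤ μ.real (⋃ x ∈ startBox w n, {ξ | ↑(levelWindow x n) ⊆ ξ}) :=
        measureReal_mono hsub (measure_ne_top _ _)
    _ ≤ ∑ x ∈ startBox w n, μ.real {ξ | ↑(levelWindow x n) ⊆ ξ} := measureReal_biUnion_finset_le _ _
    _ = 2 * (n + 1) * (1 / 16 : ℝ) ^ n := by
        simp only [hcyl, Finset.sum_const, card_startBox, nsmul_eq_mul]
        push_cast
        ring

/-- The staircase bound tends to `0`. -/
theorem tendsto_stair_bound :
    Tendsto (fun n : ℕ => 2 * (n + 1) * (1 / 16 : ℝ) ^ n) atTop (𝓝 0) := by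
  have h1 := tendsto_self_mul_const_pow_of_lt_one (r := (1 / 16 : ℝ)) (by norm_num) (by norm_num)
  have h2 := tendsto_pow_atTop_nhds_zero_of_lt_one (r := (1 / 16 : ℝ)) (by norm_num) (by norm_num)
  have h3 := (h1.add h2).const_mul 2
  simp only [mul_zero, add_zero] at h3
  refine h3.congr fun n => ?_
  ring

/-- **No box-crossing bounds for the staircase world**, for any constants, at aspect ratio `8`. -/
theorem not_boxCrossingBounds_stairWorld {c : ℝ} (hc : 0 < c) (n₀ : ℕ) :
    ¬ BoxCrossingBounds stairWorld squareLatticeEmbedding.z 8 c n₀ := by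
  intro h
  obtain ⟨N, hN⟩ := (tendsto_stair_bound.eventually (gt_mem_nhds hc)).exists_forall_of_atTop
  have h1 := (h (max N n₀) (le_max_right _ _) 0).1.1
  have h2 := stair_hardWay_le 0 (max N n₀)
  have h3 := hN (max N n₀) (le_max_left _ _)
  linarith

/-- **The staircase world does not have the box-crossing property on `√2 ℤ²`.** -/
theorem not_hasBoxCrossingProperty_stairWorld :
    ¬ HasBoxCrossingProperty stairWorld squareLatticeEmbedding.z := by
  intro h
  obtain ⟨c, hc, n₀, hb⟩ := h 8 (by norm_num)
  exact not_boxCrossingBounds_stairWorld hc n₀ hb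

/-- **Capstone (FKG no-go form).** There is a POSITIVELY ASSOCIATED probability measure on bond
configurations of `ℤ²` — the staircase world — that is translation invariant, invariant under the
transposition of the axes and under the point reflection, EXACTLY self-dual (the dual configuration
has the same law), crosses every `(n + 1) × n` lattice rectangle with probability exactly `1/2`, and
yet does NOT have the box-crossing property on `√2 ℤ²`. Hence positive association + the Klein
symmetries + self-duality + exact-`1/2` squares do not imply the box-crossing property: the
Köhler-Schindler–Tassion RSW theorem does not survive replacing the quarter-turn by the diagonal
reflection, and any proof of `UniformBoxCrossing` must use the product structure of `M_t`
quantitatively as well as FKG. [cite: KohlerSchindlerTassion2023, Comment 5 (ω_diag)] -/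
theorem exists_fkg_selfDual_symmetric_exactHalf_not_boxCrossing :
    ∃ μ : Measure (BondConfig (Site 2)), IsProbabilityMeasure μ ∧ IsPositivelyAssociated μ ∧
      (∀ a : Site 2, μ.map (BondConfig.relabel (sym2Equiv (Site.shift a))) = μ) ∧
      μ.map (BondConfig.relabel (sym2Equiv transposeIso.toEquiv)) = μ ∧
      μ.map (BondConfig.relabel (sym2Equiv (Equiv.neg (Site 2)))) = μ ∧
      μ.map dualConfig = μ ∧
      (∀ n : ℕ, μ.real (lrCrossing (n + 1) n) = 1 / 2) ∧
      ¬ HasBoxCrossingProperty μ squareLatticeEmbedding.z :=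
  ⟨stairWorld, inferInstance, isPositivelyAssociated_stairWorld, stairWorld_map_relabel_shift,
    stairWorld_map_relabel_transpose, stairWorld_map_relabel_neg, stairWorld_map_dualConfig,
    stairWorld_real_lrCrossing_succ_self, not_hasBoxCrossingProperty_stairWorld⟩

end

end Summit.CriticalPhenomena.CardyFormulaZ2.Theorems.UniformBoxCrossing.Negative
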